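import Literature.InformationTheory.QuantumCodes.BBPinnedDistanceFlat
import Summits.Ventures.QEC.Census.BB.BB144.OrbitBZ
import Summits.Ventures.QEC.Census.CertBZWords
import HarnessLib

/-!
# Orbit averaging for information sets ("L-orb"): one information set suffices up to the automorphism group
# (qec-type-12 g4 for qec-search-9's `[[288,12,18]]` cover-reduction certificate, README §4 L-orb / §7 (R2); director R29)

The symmetry reduction behind "for a cyclic code one information set and its shifts suffice" (Grassl 2006 §2.2), in the
form a Brouwer–Zimmermann / coset-enumeration certificate replay consumes it.  Let a finite family `σ : Γ → Perm X` of
coordinate permutations preserve a block decomposition `blk : X → B` and act REGULARLY on every block (for `x, t` in one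
block there is exactly one `g` with `σ g x = t`; e.g. the translations of an abelian group acting on each block of a
two-block code).  Double counting the pairs `(g, x)` with `x ∈ c`, `σ g x ∈ T` gives

  `Σ_g |σ g '' c ∩ T| = Σ_{x ∈ c} |T ∩ block(x)| = Σ_j |c ∩ Q_j| · |T ∩ Q_j|`   (`sum_card_image_inter_eq`),

hence SOME `g` has `|Γ| · |σ g '' c ∩ T| ≤ Σ_j |c ∩ Q_j| · |T ∩ Q_j|` (`exists_card_mul_card_image_inter_le`; the integer
floor is free).  USE: if the code and the certified property are `Γ`-invariant, every word of block weights `(W_j)` has a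
transform meeting the information set `T` in `≤ ⌊Σ_j W_j |T ∩ Q_j| / |Γ|⌋` positions, so ONE information set enumerated to
that depth reaches a transform of every such word (balanced `T`, two blocks: depth `⌊k W / (2ℓm)⌋` — search-9's numbers:
level 2 `1.15e7 → 7.7e5`, the `s = 0` problem `1.51e8 → 1.24e5` selections).  Contents:

* generic: `card_image_inter_eq_card_filter`, `sum_card_image_inter_eq` (double count), `exists_card_mul_le_sum`
  (min ≤ mean in `ℕ`), `exists_card_mul_card_image_inter_le`, `sum_card_filter_two_blocks`;
* `QC(A,B)` on `(ℤ_ℓ × ℤ_m) ⊕ (ℤ_ℓ × ℤ_m)`: `BB.translate_isLeft`, `BB.translate_regular`, `BB.exists_translate_card_mul_le`;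
* FLAT indices (`qubitIndex`; block `L` = `· < ℓm`): `BB.translateFlat_lt_iff`, `BB.translateFlat_regular`,
  `BB.exists_translateFlat_card_mul_le`, and for the support of a transported vector `v ∘ (translateFlat g)⁻¹` (the `φ_g`
  of the `bz_aut` transport lemmas) `BB.exists_translateFlat_support_card_mul_le`;
* WORDS: `BB.exists_translate_popc_mul_le` — `∃ t, ℓm · popc n (permWord (translateIdx ℓ m t₁ t₂) w n &&& Tm) ≤
  popc n (w &&& low)·popc n (Tm &&& low) + (popc n w − popc n (w &&& low))·(popc n Tm − popc n (Tm &&& low))`,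
  `low = 2^{ℓm} − 1`, `n = 2ℓm` (with `bitSet_and_low`, `popc_and_low_eq_card`, `BB.bitSet_permWord_translateIdx`).

Pure finite combinatorics + the tree's flat-translation API (type-07 `BB.translateFlat`, type-12 `OrbitBZ`); tier KERNEL,
axioms standard; no certificate is read here.  Source of the idea: [Grassl 2006, §2.2] (symmetry reduction of the
information sets by code automorphisms); translations of both blocks [Bravyi et al. 2024, §4].
-/

namespace Summit.Ventures.QEC.Census

open Finset Literature.InformationTheory.QuantumCodes Literature.InformationTheory.QuantumCodes.BB

/-! ## Double counting over a block-regular family of permutations -/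

section Generic

variable {X : Type*} [DecidableEq X] {Γ : Type*} [Fintype Γ] {B : Type*} [DecidableEq B]

/-- `|σ '' c ∩ T| = |{x ∈ c : σ x ∈ T}|` for a permutation `σ`. [folklore] -/
theorem card_image_inter_eq_card_filter (σ : X ≃ X) (c T : Finset X) :
    (c.image σ ∩ T).card = (c.filter fun x => σ x ∈ T).card := by
  rw [← Finset.card_image_of_injective (c.filter fun x => σ x ∈ T) σ.injective]
  congr 1
  ext y
  simp only [Finset.mem_inter, Finset.mem_image, Finset.mem_filter]
  constructor
  · rintro ⟨⟨x, hx, rfl⟩, hy⟩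
    exact ⟨x, ⟨hx, hy⟩, rfl⟩
  · rintro ⟨x, ⟨hx, hy⟩, rfl⟩
    exact ⟨⟨x, hx, rfl⟩, hy⟩

/-- **Double counting** ("L-orb", first half): for a family of permutations preserving the blocks of `blk` and acting
regularly on each block, `Σ_g |σ g '' c ∩ T| = Σ_{x ∈ c} |{t ∈ T : t in the block of x}|`.
[cite: Grassl2006, §2.2 "Cyclic codes" p. 294 (symmetry reduction of the information sets by code automorphisms)] -/
theorem sum_card_image_inter_eq (σ : Γ → X ≃ X) (blk : X → B)
    (hreg : ∀ x t : X, blk x = blk t → ∃! g : Γ, σ g x = t) (hblk : ∀ (g : Γ) (x : X), blk (σ g x) = blk x)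
    (c T : Finset X) :
    ∑ g, (c.image (σ g) ∩ T).card = ∑ x ∈ c, (T.filter fun t => blk t = blk x).card := by
  simp_rw [card_image_inter_eq_card_filter]
  have h1 : ∀ g : Γ, ((c.filter fun x => σ g x ∈ T).card : ℕ) = ∑ x ∈ c, if σ g x ∈ T then 1 else 0 :=
    fun g => Finset.card_filter _ _
  simp_rw [h1]
  rw [Finset.sum_comm]
  refine Finset.sum_congr rfl fun x _ => ?_
  rw [← Finset.card_filter]
  refine Finset.card_bij (fun g _ => σ g x) ?_ ?_ ?_
  · intro g hg
    simp only [Finset.mem_filter, Finset.mem_univ, true_and] at hg ⊢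
    exact ⟨hg, hblk g x⟩
  · intro g₁ h₁ g₂ h₂ heq
    obtain ⟨g, -, huniq⟩ := hreg x (σ g₁ x) (hblk g₁ x).symm
    exact (huniq g₁ rfl).trans (huniq g₂ heq.symm).symm
  · intro t ht
    simp only [Finset.mem_filter] at ht
    obtain ⟨g, hg, -⟩ := hreg x t ht.2.symm
    exact ⟨g, by simp [hg, ht.1], hg⟩

/-- Minimum ≤ mean over a finite nonempty index type, in `ℕ` without division. [folklore] -/
theorem exists_card_mul_le_sum [Nonempty Γ] (f : Γ → ℕ) : ∃ g : Γ, Fintype.card Γ * f g ≤ ∑ g', f g' := by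
  obtain ⟨g, -, hg⟩ := Finset.exists_min_image Finset.univ f Finset.univ_nonempty
  refine ⟨g, ?_⟩
  calc Fintype.card Γ * f g = ∑ _g' : Γ, f g := by rw [Finset.sum_const, Finset.card_univ, smul_eq_mul]
    _ ≤ ∑ g', f g' := Finset.sum_le_sum fun g' _ => hg g' (Finset.mem_univ _)

/-- **Orbit averaging** ("L-orb"): some member of the family moves `c` to meet `T` in at most the average number of
positions: `|Γ| · |σ g '' c ∩ T| ≤ Σ_{x ∈ c} |T ∩ block(x)|`.
[cite: Grassl2006, §2.2 "Cyclic codes" p. 294 (symmetry reduction of the information sets by code automorphisms)] -/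
theorem exists_card_mul_card_image_inter_le [Nonempty Γ] (σ : Γ → X ≃ X) (blk : X → B)
    (hreg : ∀ x t : X, blk x = blk t → ∃! g : Γ, σ g x = t) (hblk : ∀ (g : Γ) (x : X), blk (σ g x) = blk x)
    (c T : Finset X) :
    ∃ g : Γ, Fintype.card Γ * (c.image (σ g) ∩ T).card ≤ ∑ x ∈ c, (T.filter fun t => blk t = blk x).card := by
  rw [← sum_card_image_inter_eq σ blk hreg hblk c T]
  exact exists_card_mul_le_sum _

omit [DecidableEq X] in
/-- The block sum for TWO blocks (`blk : X → Bool`): `Σ_{x∈c} |T ∩ block(x)| = |c ∩ Q₁|·|T ∩ Q₁| + |c ∩ Q₀|·|T ∩ Q₀|`.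
[folklore] -/
theorem sum_card_filter_two_blocks (blk : X → Bool) (c T : Finset X) :
    ∑ x ∈ c, (T.filter fun t => blk t = blk x).card =
      (c.filter fun x => blk x = true).card * (T.filter fun t => blk t = true).card +
        (c.filter fun x => blk x = false).card * (T.filter fun t => blk t = false).card := by
  rw [← Finset.sum_filter_add_sum_filter_not c (fun x => blk x = true)]
  congr 1
  · rw [Finset.sum_congr rfl (g := fun _ => (T.filter fun t => blk t = true).card), Finset.sum_const, smul_eq_mul]
    intro x hx
    rw [(Finset.mem_filter.1 hx).2]
  · have hset : (c.filter fun x => ¬ blk x = true) = c.filter fun x => blk x = false := by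
      congr 1; funext x; simp
    rw [hset, Finset.sum_congr rfl (g := fun _ => (T.filter fun t => blk t = false).card), Finset.sum_const,
      smul_eq_mul]
    intro x hx
    rw [(Finset.mem_filter.1 hx).2]

end Generic

/-! ## The instance: diagonal translations of a bivariate-bicycle code -/

section BB

variable {ℓ m : ℕ} [NeZero ℓ] [NeZero m]

/-- Translations preserve the two qubit blocks. [cite: BravyiEtAl2024, §4 (arXiv:2308.07915 chunk p0009 L42–44)] -/
theorem BB.translate_isLeft (g : Mono ℓ m) (x : Mono ℓ m ⊕ Mono ℓ m) :
    (BB.Code.translate g x).isLeft = x.isLeft := by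
  rcases x with x | x <;> rfl

/-- Translations act regularly on each block: for two qubits of the same block there is exactly one translation
carrying the first to the second. [cite: BravyiEtAl2024, §4 (arXiv:2308.07915 chunk p0009 L42–44)] -/
theorem BB.translate_regular (x t : Mono ℓ m ⊕ Mono ℓ m) (h : x.isLeft = t.isLeft) :
    ∃! g : Mono ℓ m, BB.Code.translate g x = t := by
  rcases x with x | x <;> rcases t with t | t <;> simp only [Sum.isLeft_inl, Sum.isLeft_inr] at h
  · refine ⟨t - x, ?_, ?_⟩
    · simp [BB.Code.translate]
    · intro g hg
      simp only [BB.Code.translate, Equiv.sumCongr_apply, Sum.map_inl, Equiv.coe_addRight, Sum.inl.injEq] at hg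
      rw [← hg]; abel
  · exact absurd h (by decide)
  · exact absurd h (by decide)
  · refine ⟨t - x, ?_, ?_⟩
    · simp [BB.Code.translate]
    · intro g hg
      simp only [BB.Code.translate, Equiv.sumCongr_apply, Sum.map_inr, Equiv.coe_addRight, Sum.inr.injEq] at hg
      rw [← hg]; abel

/-- **Orbit averaging for `QC(A,B)`**: for any set of qubits `c` and any set `T` (an information set) some diagonal
translation `g ∈ ℤ_ℓ × ℤ_m` has `ℓm · |g·c ∩ T| ≤ |c ∩ L|·|T ∩ L| + |c ∩ R|·|T ∩ R|`.
[cite: Grassl2006, §2.2 "Cyclic codes" p. 294 (symmetry reduction of the information sets by code automorphisms)] -/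
theorem BB.exists_translate_card_mul_le (c T : Finset (Mono ℓ m ⊕ Mono ℓ m)) :
    ∃ g : Mono ℓ m, ℓ * m * (c.image (BB.Code.translate g) ∩ T).card ≤
      (c.filter fun x => x.isLeft = true).card * (T.filter fun t => t.isLeft = true).card +
        (c.filter fun x => x.isLeft = false).card * (T.filter fun t => t.isLeft = false).card := by
  have hcard : Fintype.card (Mono ℓ m) = ℓ * m := by simp [Mono, Fintype.card_prod, Fintype.card_fin]
  obtain ⟨g, hg⟩ := exists_card_mul_card_image_inter_le (fun g : Mono ℓ m => BB.Code.translate g) Sum.isLeft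
    (fun x t h => BB.translate_regular x t h) (fun g x => BB.translate_isLeft g x) c T
  rw [sum_card_filter_two_blocks, hcard] at hg
  exact ⟨g, hg⟩

end BB


/-! ## Flat indices -/

section Flat

variable {ℓ m : ℕ} [NeZero ℓ] [NeZero m]

omit [NeZero ℓ] [NeZero m] in
/-- A flat index is in block `L` iff its preimage under `qubitIndex` is a left summand. -/
theorem BB.qubitIndex_val_lt_iff (q : Mono ℓ m ⊕ Mono ℓ m) :
    ((BB.Code.qubitIndex q : Fin (ℓ * m + ℓ * m)) : ℕ) < ℓ * m ↔ q.isLeft = true := by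
  rcases q with x | x
  · simp [BB.Code.qubitIndex_inl_val_lt x]
  · simp [not_lt.2 (BB.Code.le_qubitIndex_inr_val x)]

/-- **Flat translations preserve the blocks**: `translateFlat g i < ℓm ↔ i < ℓm`. -/
theorem BB.translateFlat_lt_iff (g : Mono ℓ m) (i : Fin (ℓ * m + ℓ * m)) :
    ((BB.translateFlat g i : Fin (ℓ * m + ℓ * m)) : ℕ) < ℓ * m ↔ (i : ℕ) < ℓ * m := by
  obtain ⟨q, rfl⟩ := BB.Code.qubitIndex.surjective i
  rw [BB.translateFlat_qubitIndex, BB.qubitIndex_val_lt_iff, BB.qubitIndex_val_lt_iff, BB.translate_isLeft]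

/-- **Flat translations act regularly on each block**: two flat indices of the same block are related by exactly one
translation. -/
theorem BB.translateFlat_regular (i j : Fin (ℓ * m + ℓ * m))
    (h : decide ((i : ℕ) < ℓ * m) = decide ((j : ℕ) < ℓ * m)) : ∃! g : Mono ℓ m, BB.translateFlat g i = j := by
  obtain ⟨qi, rfl⟩ := BB.Code.qubitIndex.surjective i
  obtain ⟨qj, rfl⟩ := BB.Code.qubitIndex.surjective j
  have h' : qi.isLeft = qj.isLeft := by
    have hi := BB.qubitIndex_val_lt_iff (ℓ := ℓ) (m := m) qi
    have hj := BB.qubitIndex_val_lt_iff (ℓ := ℓ) (m := m) qj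
    revert h; cases hqi : qi.isLeft <;> cases hqj : qj.isLeft <;> simp_all
  obtain ⟨g, hg, huniq⟩ := BB.translate_regular qi qj h'
  refine ⟨g, ?_, fun g' hg' => huniq g' ?_⟩
  · show BB.translateFlat g (BB.Code.qubitIndex qi) = BB.Code.qubitIndex qj
    rw [BB.translateFlat_qubitIndex, hg]
  · have hg'' : BB.translateFlat g' (BB.Code.qubitIndex qi) = BB.Code.qubitIndex qj := hg'
    rw [BB.translateFlat_qubitIndex] at hg''
    exact BB.Code.qubitIndex.injective hg''

/-- **Orbit averaging on flat indices**: for any qubit sets `c`, `T` some flat translation `g` has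
`ℓm · |translateFlat g '' c ∩ T| ≤ |c ∩ L|·|T ∩ L| + |c ∩ R|·|T ∩ R|` (`L` = indices `< ℓm`, `R` = the rest). -/
theorem BB.exists_translateFlat_card_mul_le (c T : Finset (Fin (ℓ * m + ℓ * m))) :
    ∃ g : Mono ℓ m, ℓ * m * (c.image (BB.translateFlat g) ∩ T).card ≤
      (c.filter fun i => i.val < ℓ * m).card * (T.filter fun i => i.val < ℓ * m).card +
        (c.filter fun i => ¬ i.val < ℓ * m).card * (T.filter fun i => ¬ i.val < ℓ * m).card := by
  have hcard : Fintype.card (Mono ℓ m) = ℓ * m := by simp [Mono, Fintype.card_prod, Fintype.card_fin]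
  obtain ⟨g, hg⟩ := exists_card_mul_card_image_inter_le (fun g : Mono ℓ m => BB.translateFlat g)
    (fun i : Fin (ℓ * m + ℓ * m) => decide ((i : ℕ) < ℓ * m))
    (fun x t h => BB.translateFlat_regular x t h)
    (fun g x => by rw [Bool.decide_congr (BB.translateFlat_lt_iff g x)]) c T
  rw [sum_card_filter_two_blocks, hcard] at hg
  simp only [decide_eq_true_eq, decide_eq_false_iff_not] at hg
  exact ⟨g, hg⟩

/-- The support of a transported vector is the image of the support. -/
theorem support_comp_equiv_symm {n : ℕ} (v : Fin n → ZMod 2) (σ : Fin n ≃ Fin n) :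
    (Finset.univ.filter fun i => (v ∘ σ.symm) i ≠ 0) = (Finset.univ.filter fun i => v i ≠ 0).image σ := by
  ext j
  simp only [Finset.mem_filter, Finset.mem_univ, true_and, Function.comp_apply, Finset.mem_image]
  constructor
  · intro h; exact ⟨σ.symm j, h, by simp⟩
  · rintro ⟨i, hi, rfl⟩; simpa using hi

/-- **Orbit averaging for the SUPPORT of a transported vector** (the `φ_g z := z ∘ (translateFlat g)⁻¹` of the `bz_aut`
transport lemmas): some translate of `v` meets `T` in at most the average number of positions. -/
theorem BB.exists_translateFlat_support_card_mul_le (v : Fin (ℓ * m + ℓ * m) → ZMod 2) (T : Finset (Fin (ℓ * m + ℓ * m))) :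
    ∃ g : Mono ℓ m, ℓ * m * ((Finset.univ.filter fun i => (v ∘ (BB.translateFlat g).symm) i ≠ 0) ∩ T).card ≤
      ((Finset.univ.filter fun i => v i ≠ 0).filter fun i => i.val < ℓ * m).card *
          (T.filter fun i => i.val < ℓ * m).card +
        ((Finset.univ.filter fun i => v i ≠ 0).filter fun i => ¬ i.val < ℓ * m).card *
          (T.filter fun i => ¬ i.val < ℓ * m).card := by
  obtain ⟨g, hg⟩ := BB.exists_translateFlat_card_mul_le (Finset.univ.filter fun i => v i ≠ 0) T
  exact ⟨g, by rw [support_comp_equiv_symm]; exact hg⟩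

end Flat

/-! ## Word level (`popc`, `permWord`, masks) -/

section Words

variable {ℓ m : ℕ} [NeZero ℓ] [NeZero m]

/-- The bit set of `a &&& (2^s − 1)` is the part of the bit set of `a` below `s`. -/
theorem bitSet_and_low (n a s : ℕ) :
    bitSet n (a &&& (2 ^ s - 1)) = (bitSet n a).filter fun i => i.val < s := by
  ext i
  rw [Finset.mem_filter, mem_bitSet, mem_bitSet, Nat.testBit_and, Bool.and_eq_true, Nat.testBit_two_pow_sub_one,
    decide_eq_true_eq]

/-- `popc n (a &&& low) = |bits of a below ℓm|` and the complement count, `low = 2^{ℓm} − 1`. -/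
theorem popc_and_low_eq_card (n a s : ℕ) :
    popc n (a &&& (2 ^ s - 1)) = ((bitSet n a).filter fun i => i.val < s).card ∧
      popc n a - popc n (a &&& (2 ^ s - 1)) = ((bitSet n a).filter fun i => ¬ i.val < s).card := by
  have h1 : popc n (a &&& (2 ^ s - 1)) = ((bitSet n a).filter fun i => i.val < s).card := by
    rw [← card_bitSet, bitSet_and_low]
  refine ⟨h1, ?_⟩
  rw [h1, ← card_bitSet, ← Finset.card_filter_add_card_filter_not (s := bitSet n a) (fun i => i.val < s)]
  simp

/-- The bit set of the translated word is the translate of the bit set. -/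
theorem BB.bitSet_permWord_translateIdx (t : Mono ℓ m) (w : ℕ) :
    bitSet (ℓ * m + ℓ * m) (permWord (BB.translateIdx ℓ m t.1 t.2) w (ℓ * m + ℓ * m)) =
      (bitSet (ℓ * m + ℓ * m) w).image (BB.translateFlat t) := by
  rw [← support_ofBits, ← support_ofBits, ← BB.ofBits_comp_translateFlat_symm, support_comp_equiv_symm]

/-- **Orbit averaging, word level** (`n = 2ℓm`, `low = 2^{ℓm} − 1`): for a vector word `w` and an information-set mask
`Tm` some translation `t = (t₁, t₂)` has
`ℓm · popc n (permWord (translateIdx ℓ m t₁ t₂) w n &&& Tm) ≤ popc n (w &&& low) · popc n (Tm &&& low) +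
(popc n w − popc n (w &&& low)) · (popc n Tm − popc n (Tm &&& low))` — the depth bound a one-information-set
enumeration of a translation-invariant problem may use. -/
theorem BB.exists_translate_popc_mul_le (w Tm : ℕ) :
    ∃ t : Mono ℓ m, ℓ * m *
        popc (ℓ * m + ℓ * m) (permWord (BB.translateIdx ℓ m t.1 t.2) w (ℓ * m + ℓ * m) &&& Tm) ≤
      popc (ℓ * m + ℓ * m) (w &&& (2 ^ (ℓ * m) - 1)) * popc (ℓ * m + ℓ * m) (Tm &&& (2 ^ (ℓ * m) - 1)) +
        (popc (ℓ * m + ℓ * m) w - popc (ℓ * m + ℓ * m) (w &&& (2 ^ (ℓ * m) - 1))) *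
          (popc (ℓ * m + ℓ * m) Tm - popc (ℓ * m + ℓ * m) (Tm &&& (2 ^ (ℓ * m) - 1))) := by
  obtain ⟨g, hg⟩ := BB.exists_translateFlat_card_mul_le (ℓ := ℓ) (m := m)
    (bitSet (ℓ * m + ℓ * m) w) (bitSet (ℓ * m + ℓ * m) Tm)
  refine ⟨g, ?_⟩
  obtain ⟨hw1, hw2⟩ := popc_and_low_eq_card (ℓ * m + ℓ * m) w (ℓ * m)
  obtain ⟨hT1, hT2⟩ := popc_and_low_eq_card (ℓ * m + ℓ * m) Tm (ℓ * m)
  rw [hw2, hT2, hw1, hT1, ← card_bitSet, bitSet_and, BB.bitSet_permWord_translateIdx]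
  exact hg

end Words

end Summit.Ventures.QEC.Census
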